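import Literature.AlgebraicGeometry.Motives.MixedHodgeExtensionNonSeparatedGroup
import Literature.AlgebraicGeometry.Motives.MixedHodgeExtensionPushout
import Literature.AlgebraicGeometry.Motives.MixedHodgeExtensionPullback
import Literature.AlgebraicGeometry.Motives.MixedHodgeStructureInternalHomMorphisms
import HarnessLib

/-!
# The internal Hom of an extension: `Hom(C, E)` and `Hom(E, C)` as extensions of mixed Hodge structures

Deligne, *Théorie de Hodge II*, 1.1.12 and Thm. 2.3.5: the internal `Hom` of mixed Hodge structures is
a functor of bifiltered objects and every morphism of MHS is strict, so the category of MHS is abelian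
and `Hom(C, −)`, `Hom(−, C)` (exact on the underlying `ℚ`-vector spaces) carry short exact sequences of
MHS to short exact sequences of MHS. Carlson, *Extensions of mixed Hodge structures* (1980), §2(c)
Remark (3) uses the "dual extension" `0 → Â → Ĥ → B̂ → 0` (`Hom(−, ℚ(0))`); Jannsen, *Mixed Motives*
(LNM 1400), §9 Remark 9.3 a) tensors extensions with a fixed MHS (the tree's `Extension.rTensor`).
This file constructs, for an extension `E : 0 → B —i→ E —π→ A → 0` and a mixed Hodge structure `C`
(all carriers finite-dimensional):

* §1 **`Extension.homLeft E C : 0 → Hom(C, B) → Hom(C, E) → Hom(C, A) → 0`** (`Hom(C, i)`, `Hom(C, π)`;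
  exact since `C` is a projective `ℚ`-module) and
  **`Extension.homRight E C : 0 → Hom(A, C) → Hom(E, C) → Hom(B, C) → 0`** (`Hom(π, C)`, `Hom(i, C)`;
  exact since `C` is an injective `ℚ`-module), via `Extension.ofExact` (strictness by Deligne's theorem);
* §2 functoriality: `Morphism.homLeft/homRight`, `Congruence.homLeft/homRight`, `Splitting.homLeft/homRight`
  (`IsSplit.homLeft/homRight`), and compatibility with push-out and pull-back up to congruence:
  `Hom(C, g_* E) ≡ Hom(C, g)_* Hom(C, E)`, `Hom(C, f^* E) ≡ Hom(C, f)^* Hom(C, E)`,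
  `Hom(g_* E, C) ≡ Hom(g, C)^* Hom(E, C)`, `Hom(f^* E, C) ≡ Hom(f, C)_* Hom(E, C)` (Mac Lane's uniqueness);
* §3 the induced maps on congruence classes **`Ext.homLeftMap C : Ext(A, B) → Ext(Hom(C, A), Hom(C, B))`**
  and **`Ext.homRightMap C : Ext(A, B) → Ext(Hom(B, C), Hom(A, C))`**, their values on `mkOfW`, the split
  class, and naturality.

All statements proved; no named facts.

## References

* [DeligneHodgeII1971] P. Deligne, Théorie de Hodge II, 1.1.12, Thm. 2.3.5.
* [Carlson1980] J. A. Carlson, Extensions of mixed Hodge structures (1980), §2(b) Prop. 1, §2(c)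
  Remark (3).
* [MacLane1963Homology] S. Mac Lane, Homology (1963), Ch. III §1 Lemmas 1.2, 1.4.
* [Jannsen1990MixedMotives] U. Jannsen, Mixed Motives and Algebraic K-Theory, LNM 1400 (1990), §9
  Remark 9.3 a).
-/

noncomputable section

namespace Literature.AlgebraicGeometry.Motives

namespace MixedHodgeStructure

universe u v w x u' v' w'

variable {VA : Type u} [AddCommGroup VA] [Module ℚ VA] [FiniteDimensional ℚ VA]
variable {VB : Type v} [AddCommGroup VB] [Module ℚ VB] [FiniteDimensional ℚ VB]
variable {VE : Type w} [AddCommGroup VE] [Module ℚ VE] [FiniteDimensional ℚ VE]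
variable {VC : Type x} [AddCommGroup VC] [Module ℚ VC] [FiniteDimensional ℚ VC]
variable {VA' : Type u'} [AddCommGroup VA'] [Module ℚ VA'] [FiniteDimensional ℚ VA']
variable {VB' : Type v'} [AddCommGroup VB'] [Module ℚ VB'] [FiniteDimensional ℚ VB']
variable {VE' : Type w'} [AddCommGroup VE'] [Module ℚ VE'] [FiniteDimensional ℚ VE']

/-! ### §0 Plumbing for `Hom(C, g)` and `Hom(f, C)` -/

section Plumbing

variable {H₁ : MixedHodgeStructure VA} {H₂ : MixedHodgeStructure VB} {H₃ : MixedHodgeStructure VE}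
  (C : MixedHodgeStructure VC)

omit [FiniteDimensional ℚ VA] [FiniteDimensional ℚ VB] [FiniteDimensional ℚ VE] [FiniteDimensional ℚ VC] in
/-- `id_C ∘ id_C = id_C`. [cite: DeligneHodgeII1971, 1.1.12] -/
theorem Hom.id_comp_id : (Hom.id C).comp (Hom.id C) = Hom.id C :=
  Hom.ext (by rw [Hom.comp_toLinearMap, Hom.id_toLinearMap, LinearMap.comp_id])

omit [FiniteDimensional ℚ VE] in
/-- `Hom(C, g)(φ) = g ∘ φ`. [cite: DeligneHodgeII1971, 1.1.12] -/
theorem Hom.homMap_id_toLinearMap_apply (g : Hom H₁ H₂) (φ : VC →ₗ[ℚ] VA) :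
    (Hom.homMap (Hom.id C) g).toLinearMap φ = g.toLinearMap ∘ₗ φ := by
  rw [Hom.homMap_toLinearMap_apply, Hom.id_toLinearMap, LinearMap.comp_id]

omit [FiniteDimensional ℚ VE] in
/-- `Hom(f, C)(ψ) = ψ ∘ f`. [cite: DeligneHodgeII1971, 1.1.12] -/
theorem Hom.homMap_id_toLinearMap_apply' (f : Hom H₁ H₂) (ψ : VB →ₗ[ℚ] VC) :
    (Hom.homMap f (Hom.id C)).toLinearMap ψ = ψ ∘ₗ f.toLinearMap := by
  rw [Hom.homMap_toLinearMap_apply, Hom.id_toLinearMap, LinearMap.id_comp]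

/-- `Hom(C, g') ∘ Hom(C, g) = Hom(C, g' ∘ g)` on underlying maps. [cite: DeligneHodgeII1971, 1.1.12] -/
theorem Hom.homMap_id_comp_toLinearMap (g' : Hom H₂ H₃) (g : Hom H₁ H₂) :
    (Hom.homMap (Hom.id C) g').toLinearMap ∘ₗ (Hom.homMap (Hom.id C) g).toLinearMap =
      (Hom.homMap (Hom.id C) (g'.comp g)).toLinearMap := by
  rw [← Hom.comp_toLinearMap, ← Hom.homMap_comp, Hom.id_comp_id]

/-- `Hom(f, C) ∘ Hom(f', C) = Hom(f' ∘ f, C)` on underlying maps. [cite: DeligneHodgeII1971, 1.1.12] -/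
theorem Hom.homMap_id_comp_toLinearMap' (f : Hom H₁ H₂) (f' : Hom H₂ H₃) :
    (Hom.homMap f (Hom.id C)).toLinearMap ∘ₗ (Hom.homMap f' (Hom.id C)).toLinearMap =
      (Hom.homMap (f'.comp f) (Hom.id C)).toLinearMap := by
  rw [← Hom.comp_toLinearMap, ← Hom.homMap_comp, Hom.id_comp_id]

omit [FiniteDimensional ℚ VE] in
/-- `Hom(C, id) = id` on underlying maps. [cite: DeligneHodgeII1971, 1.1.12] -/
theorem Hom.homMap_id_id_toLinearMap : (Hom.homMap (Hom.id C) (Hom.id H₁)).toLinearMap = LinearMap.id := by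
  rw [Hom.homMap_id, Hom.id_toLinearMap]

end Plumbing

namespace Extension

variable {A : MixedHodgeStructure VA} {B : MixedHodgeStructure VB}
variable {A' : MixedHodgeStructure VA'} {B' : MixedHodgeStructure VB'}
variable (E : Extension A B VE) (C : MixedHodgeStructure VC)

/-! ### §1 `Hom(C, E)` and `Hom(E, C)` -/

omit [FiniteDimensional ℚ VA] [FiniteDimensional ℚ VB] [FiniteDimensional ℚ VE] [FiniteDimensional ℚ VC]
  [FiniteDimensional ℚ VA'] [FiniteDimensional ℚ VB'] [FiniteDimensional ℚ VE'] [AddCommGroup VA']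
  [Module ℚ VA'] [AddCommGroup VB'] [Module ℚ VB'] [AddCommGroup VE'] [Module ℚ VE'] in
/-- `Hom_ℚ(C, −)` is exact at the middle: `π ∘ φ = 0 ↔ φ = i ∘ ψ`. [cite: MacLane1963Homology, Ch. III §1] -/
theorem exact_postcomp :
    Function.Exact (fun ψ : VC →ₗ[ℚ] VB => E.inc.toLinearMap ∘ₗ ψ) (fun φ : VC →ₗ[ℚ] VE => E.proj.toLinearMap ∘ₗ φ) := by
  intro φ
  constructor
  · intro hφ
    have hle : LinearMap.range φ ≤ LinearMap.range E.inc.toLinearMap := by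
      rw [E.range_inc]
      rintro _ ⟨c, rfl⟩
      exact LinearMap.congr_fun hφ c
    exact ⟨liftOfRangeLE E.inc.toLinearMap E.injective_inc φ hle, comp_liftOfRangeLE _ _ _ hle⟩
  · rintro ⟨ψ, rfl⟩
    refine LinearMap.ext fun c => ?_
    simp only [LinearMap.comp_apply, proj_inc, LinearMap.zero_apply]

omit [FiniteDimensional ℚ VA] [FiniteDimensional ℚ VB] [FiniteDimensional ℚ VE] [FiniteDimensional ℚ VC]
  [FiniteDimensional ℚ VA'] [FiniteDimensional ℚ VB'] [FiniteDimensional ℚ VE'] [AddCommGroup VA']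
  [Module ℚ VA'] [AddCommGroup VB'] [Module ℚ VB'] [AddCommGroup VE'] [Module ℚ VE'] in
/-- `Hom_ℚ(−, C)` is exact at the middle: `ψ ∘ i = 0 ↔ ψ = φ ∘ π`. [cite: MacLane1963Homology, Ch. III §1] -/
theorem exact_precomp :
    Function.Exact (fun φ : VA →ₗ[ℚ] VC => φ ∘ₗ E.proj.toLinearMap) (fun ψ : VE →ₗ[ℚ] VC => ψ ∘ₗ E.inc.toLinearMap) := by
  intro ψ
  constructor
  · intro hψ
    obtain ⟨s, hs⟩ := E.proj.toLinearMap.exists_rightInverse_of_surjective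
      (LinearMap.range_eq_top.2 E.surjective_proj)
    refine ⟨ψ ∘ₗ s, LinearMap.ext fun x => ?_⟩
    -- `x - s (π x) ∈ ker π = im i`, on which `ψ` vanishes
    have hx : E.proj.toLinearMap (x - s (E.proj.toLinearMap x)) = 0 := by
      rw [map_sub, ← LinearMap.comp_apply, hs, LinearMap.id_apply, sub_self]
    obtain ⟨b, hb⟩ := (E.exact _).1 hx
    have hψ' : ψ ∘ₗ E.inc.toLinearMap = 0 := hψ
    have h0 : ψ (x - s (E.proj.toLinearMap x)) = 0 := by
      rw [← hb, ← LinearMap.comp_apply, hψ', LinearMap.zero_apply]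
    rw [map_sub, sub_eq_zero] at h0
    rw [LinearMap.comp_apply, LinearMap.comp_apply, h0]
  · rintro ⟨φ, rfl⟩
    refine LinearMap.ext fun b => ?_
    simp only [LinearMap.comp_apply, proj_inc, map_zero, LinearMap.zero_apply]

omit [FiniteDimensional ℚ VA'] [FiniteDimensional ℚ VB'] [FiniteDimensional ℚ VE'] [AddCommGroup VA']
  [Module ℚ VA'] [AddCommGroup VB'] [Module ℚ VB'] [AddCommGroup VE'] [Module ℚ VE'] in
/-- **`Hom(C, E) : 0 → Hom(C, B) —Hom(C,i)→ Hom(C, E) —Hom(C,π)→ Hom(C, A) → 0`**, an extension of mixed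
Hodge structures (`Hom(C, −)` of the internal Hom is exact: `C` is `ℚ`-projective; `Hom(C, i)`,
`Hom(C, π)` are morphisms of MHS, hence strict). [cite: DeligneHodgeII1971, 1.1.12 and Thm. 2.3.5] -/
def homLeft : Extension (hom C A) (hom C B) (VC →ₗ[ℚ] VE) :=
  Extension.ofExact (hom C E.mhs) (Hom.homMap (Hom.id C) E.inc) (Hom.homMap (Hom.id C) E.proj)
    (fun φ ψ h => by
      rw [Hom.homMap_id_toLinearMap_apply, Hom.homMap_id_toLinearMap_apply] at h
      exact LinearMap.ext fun c => E.injective_inc (LinearMap.congr_fun h c))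
    (fun g => by
      obtain ⟨s, hs⟩ := E.proj.toLinearMap.exists_rightInverse_of_surjective
        (LinearMap.range_eq_top.2 E.surjective_proj)
      exact ⟨s ∘ₗ g, by rw [Hom.homMap_id_toLinearMap_apply, ← LinearMap.comp_assoc, hs, LinearMap.id_comp]⟩)
    (fun φ => by
      rw [Hom.homMap_id_toLinearMap_apply]
      refine (E.exact_postcomp φ).trans ?_
      constructor
      · rintro ⟨ψ, rfl⟩
        exact ⟨ψ, Hom.homMap_id_toLinearMap_apply C E.inc ψ⟩
      · rintro ⟨ψ, hψ⟩
        exact ⟨ψ, by rw [← hψ, Hom.homMap_id_toLinearMap_apply]⟩)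

omit [FiniteDimensional ℚ VA'] [FiniteDimensional ℚ VB'] [FiniteDimensional ℚ VE'] [AddCommGroup VA']
  [Module ℚ VA'] [AddCommGroup VB'] [Module ℚ VB'] [AddCommGroup VE'] [Module ℚ VE'] in
/-- The middle term of `Hom(C, E)` is the internal `Hom(C, E)` (by `rfl`). [cite: DeligneHodgeII1971, 1.1.12] -/
@[simp]
theorem homLeft_mhs : (E.homLeft C).mhs = hom C E.mhs := rfl

omit [FiniteDimensional ℚ VA'] [FiniteDimensional ℚ VB'] [FiniteDimensional ℚ VE'] [AddCommGroup VA']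
  [Module ℚ VA'] [AddCommGroup VB'] [Module ℚ VB'] [AddCommGroup VE'] [Module ℚ VE'] in
/-- The inclusion of `Hom(C, E)` is `Hom(C, i)` (by `rfl`). [cite: DeligneHodgeII1971, 1.1.12] -/
@[simp]
theorem homLeft_inc : (E.homLeft C).inc = Hom.homMap (Hom.id C) E.inc := rfl

omit [FiniteDimensional ℚ VA'] [FiniteDimensional ℚ VB'] [FiniteDimensional ℚ VE'] [AddCommGroup VA']
  [Module ℚ VA'] [AddCommGroup VB'] [Module ℚ VB'] [AddCommGroup VE'] [Module ℚ VE'] in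
/-- The projection of `Hom(C, E)` is `Hom(C, π)` (by `rfl`). [cite: DeligneHodgeII1971, 1.1.12] -/
@[simp]
theorem homLeft_proj : (E.homLeft C).proj = Hom.homMap (Hom.id C) E.proj := rfl

omit [FiniteDimensional ℚ VA'] [FiniteDimensional ℚ VB'] [FiniteDimensional ℚ VE'] [AddCommGroup VA']
  [Module ℚ VA'] [AddCommGroup VB'] [Module ℚ VB'] [AddCommGroup VE'] [Module ℚ VE'] in
/-- **`Hom(E, C) : 0 → Hom(A, C) —Hom(π,C)→ Hom(E, C) —Hom(i,C)→ Hom(B, C) → 0`**, an extension of mixed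
Hodge structures (`Hom(−, C)` is exact: `C` is `ℚ`-injective; Carlson's "dual extension" for
`C = ℚ(0)`). [cite: DeligneHodgeII1971, 1.1.12 and Thm. 2.3.5] [cite: Carlson1980, §2(c) Remark (3)] -/
def homRight : Extension (hom B C) (hom A C) (VE →ₗ[ℚ] VC) :=
  Extension.ofExact (hom E.mhs C) (Hom.homMap E.proj (Hom.id C)) (Hom.homMap E.inc (Hom.id C))
    (fun φ φ' h => by
      rw [Hom.homMap_id_toLinearMap_apply', Hom.homMap_id_toLinearMap_apply'] at h
      exact (LinearMap.cancel_right E.surjective_proj).1 h)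
    (fun g => by
      obtain ⟨r, hr⟩ := E.inc.toLinearMap.exists_leftInverse_of_injective
        (LinearMap.ker_eq_bot.2 E.injective_inc)
      exact ⟨g ∘ₗ r, by rw [Hom.homMap_id_toLinearMap_apply', LinearMap.comp_assoc, hr, LinearMap.comp_id]⟩)
    (fun ψ => by
      rw [Hom.homMap_id_toLinearMap_apply']
      refine (E.exact_precomp ψ).trans ?_
      constructor
      · rintro ⟨φ, rfl⟩
        exact ⟨φ, Hom.homMap_id_toLinearMap_apply' C E.proj φ⟩
      · rintro ⟨φ, hφ⟩
        exact ⟨φ, by rw [← hφ, Hom.homMap_id_toLinearMap_apply']⟩)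

omit [FiniteDimensional ℚ VA'] [FiniteDimensional ℚ VB'] [FiniteDimensional ℚ VE'] [AddCommGroup VA']
  [Module ℚ VA'] [AddCommGroup VB'] [Module ℚ VB'] [AddCommGroup VE'] [Module ℚ VE'] in
/-- The middle term of `Hom(E, C)` is the internal `Hom(E, C)` (by `rfl`). [cite: DeligneHodgeII1971, 1.1.12] -/
@[simp]
theorem homRight_mhs : (E.homRight C).mhs = hom E.mhs C := rfl

omit [FiniteDimensional ℚ VA'] [FiniteDimensional ℚ VB'] [FiniteDimensional ℚ VE'] [AddCommGroup VA']
  [Module ℚ VA'] [AddCommGroup VB'] [Module ℚ VB'] [AddCommGroup VE'] [Module ℚ VE'] in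
/-- The inclusion of `Hom(E, C)` is `Hom(π, C)` (by `rfl`). [cite: DeligneHodgeII1971, 1.1.12] -/
@[simp]
theorem homRight_inc : (E.homRight C).inc = Hom.homMap E.proj (Hom.id C) := rfl

omit [FiniteDimensional ℚ VA'] [FiniteDimensional ℚ VB'] [FiniteDimensional ℚ VE'] [AddCommGroup VA']
  [Module ℚ VA'] [AddCommGroup VB'] [Module ℚ VB'] [AddCommGroup VE'] [Module ℚ VE'] in
/-- The projection of `Hom(E, C)` is `Hom(i, C)` (by `rfl`). [cite: DeligneHodgeII1971, 1.1.12] -/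
@[simp]
theorem homRight_proj : (E.homRight C).proj = Hom.homMap E.inc (Hom.id C) := rfl

/-! ### §2 Functoriality -/

variable {E C}

/-- **A morphism `(β, φ, α) : E → E'` induces `(Hom(C,β), Hom(C,φ), Hom(C,α)) : Hom(C, E) → Hom(C, E')`.**
[cite: DeligneHodgeII1971, 1.1.12] [cite: MacLane1963Homology, Ch. III §1] -/
def Morphism.homLeft {E' : Extension A' B' VE'} (m : Morphism E E') (C : MixedHodgeStructure VC) :
    Morphism (E.homLeft C) (E'.homLeft C) where
  left := Hom.homMap (Hom.id C) m.left
  mid := Hom.homMap (Hom.id C) m.mid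
  right := Hom.homMap (Hom.id C) m.right
  mid_inc := by
    change (Hom.homMap (Hom.id C) m.mid).toLinearMap ∘ₗ (Hom.homMap (Hom.id C) E.inc).toLinearMap =
      (Hom.homMap (Hom.id C) E'.inc).toLinearMap ∘ₗ (Hom.homMap (Hom.id C) m.left).toLinearMap
    rw [Hom.homMap_id_comp_toLinearMap, Hom.homMap_id_comp_toLinearMap,
      show m.mid.comp E.inc = E'.inc.comp m.left from Hom.ext m.mid_inc]
  proj_mid := by
    change (Hom.homMap (Hom.id C) E'.proj).toLinearMap ∘ₗ (Hom.homMap (Hom.id C) m.mid).toLinearMap =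
      (Hom.homMap (Hom.id C) m.right).toLinearMap ∘ₗ (Hom.homMap (Hom.id C) E.proj).toLinearMap
    rw [Hom.homMap_id_comp_toLinearMap, Hom.homMap_id_comp_toLinearMap,
      show E'.proj.comp m.mid = m.right.comp E.proj from Hom.ext m.proj_mid]

/-- **A morphism `(β, φ, α) : E → E'` induces `(Hom(α,C), Hom(φ,C), Hom(β,C)) : Hom(E', C) → Hom(E, C)`**
(contravariant). [cite: DeligneHodgeII1971, 1.1.12] [cite: MacLane1963Homology, Ch. III §1] -/
def Morphism.homRight {E' : Extension A' B' VE'} (m : Morphism E E') (C : MixedHodgeStructure VC) :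
    Morphism (E'.homRight C) (E.homRight C) where
  left := Hom.homMap m.right (Hom.id C)
  mid := Hom.homMap m.mid (Hom.id C)
  right := Hom.homMap m.left (Hom.id C)
  mid_inc := by
    change (Hom.homMap m.mid (Hom.id C)).toLinearMap ∘ₗ (Hom.homMap E'.proj (Hom.id C)).toLinearMap =
      (Hom.homMap E.proj (Hom.id C)).toLinearMap ∘ₗ (Hom.homMap m.right (Hom.id C)).toLinearMap
    rw [Hom.homMap_id_comp_toLinearMap', Hom.homMap_id_comp_toLinearMap',
      show E'.proj.comp m.mid = m.right.comp E.proj from Hom.ext m.proj_mid]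
  proj_mid := by
    change (Hom.homMap E.inc (Hom.id C)).toLinearMap ∘ₗ (Hom.homMap m.mid (Hom.id C)).toLinearMap =
      (Hom.homMap m.left (Hom.id C)).toLinearMap ∘ₗ (Hom.homMap E'.inc (Hom.id C)).toLinearMap
    rw [Hom.homMap_id_comp_toLinearMap', Hom.homMap_id_comp_toLinearMap',
      show m.mid.comp E.inc = E'.inc.comp m.left from Hom.ext m.mid_inc]

omit [FiniteDimensional ℚ VA'] [FiniteDimensional ℚ VB'] [AddCommGroup VA'] [Module ℚ VA'] [AddCommGroup VB']
  [Module ℚ VB'] in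
/-- **Congruent extensions have congruent `Hom(C, −)`.** [cite: MacLane1963Homology, Ch. III §1] -/
def Congruence.homLeft {E' : Extension A B VE'} (c : Congruence E E') (C : MixedHodgeStructure VC) :
    Congruence (E.homLeft C) (E'.homLeft C) where
  hom := Hom.homMap (Hom.id C) c.hom
  inv := Hom.homMap (Hom.id C) c.inv
  hom_inv := by
    rw [Hom.homMap_id_comp_toLinearMap, show c.hom.comp c.inv = Hom.id _ from Hom.ext c.hom_inv,
      Hom.homMap_id_id_toLinearMap]
  inv_hom := by
    rw [Hom.homMap_id_comp_toLinearMap, show c.inv.comp c.hom = Hom.id _ from Hom.ext c.inv_hom,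
      Hom.homMap_id_id_toLinearMap]
  hom_inc := by
    change (Hom.homMap (Hom.id C) c.hom).toLinearMap ∘ₗ (Hom.homMap (Hom.id C) E.inc).toLinearMap =
      (Hom.homMap (Hom.id C) E'.inc).toLinearMap
    rw [Hom.homMap_id_comp_toLinearMap, show c.hom.comp E.inc = E'.inc from Hom.ext c.hom_inc]
  proj_hom := by
    change (Hom.homMap (Hom.id C) E'.proj).toLinearMap ∘ₗ (Hom.homMap (Hom.id C) c.hom).toLinearMap =
      (Hom.homMap (Hom.id C) E.proj).toLinearMap
    rw [Hom.homMap_id_comp_toLinearMap, show E'.proj.comp c.hom = E.proj from Hom.ext c.proj_hom]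

omit [FiniteDimensional ℚ VA'] [FiniteDimensional ℚ VB'] [AddCommGroup VA'] [Module ℚ VA'] [AddCommGroup VB']
  [Module ℚ VB'] in
/-- **Congruent extensions have congruent `Hom(−, C)`.** [cite: MacLane1963Homology, Ch. III §1] -/
def Congruence.homRight {E' : Extension A B VE'} (c : Congruence E E') (C : MixedHodgeStructure VC) :
    Congruence (E'.homRight C) (E.homRight C) where
  hom := Hom.homMap c.hom (Hom.id C)
  inv := Hom.homMap c.inv (Hom.id C)
  hom_inv := by
    rw [Hom.homMap_id_comp_toLinearMap', show c.inv.comp c.hom = Hom.id _ from Hom.ext c.inv_hom,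
      Hom.homMap_id_id_toLinearMap]
  inv_hom := by
    rw [Hom.homMap_id_comp_toLinearMap', show c.hom.comp c.inv = Hom.id _ from Hom.ext c.hom_inv,
      Hom.homMap_id_id_toLinearMap]
  hom_inc := by
    change (Hom.homMap c.hom (Hom.id C)).toLinearMap ∘ₗ (Hom.homMap E'.proj (Hom.id C)).toLinearMap =
      (Hom.homMap E.proj (Hom.id C)).toLinearMap
    rw [Hom.homMap_id_comp_toLinearMap', show E'.proj.comp c.hom = E.proj from Hom.ext c.proj_hom]
  proj_hom := by
    change (Hom.homMap E.inc (Hom.id C)).toLinearMap ∘ₗ (Hom.homMap c.hom (Hom.id C)).toLinearMap =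
      (Hom.homMap E'.inc (Hom.id C)).toLinearMap
    rw [Hom.homMap_id_comp_toLinearMap', show c.hom.comp E.inc = E'.inc from Hom.ext c.hom_inc]

omit [FiniteDimensional ℚ VA'] [FiniteDimensional ℚ VB'] [AddCommGroup VA'] [Module ℚ VA'] [AddCommGroup VB']
  [Module ℚ VB'] in
/-- `E ≡ E' ⇒ Hom(C, E) ≡ Hom(C, E')`. [cite: MacLane1963Homology, Ch. III §1] -/
theorem nonempty_congruence_homLeft {E' : Extension A B VE'} (h : Nonempty (Congruence E E'))
    (C : MixedHodgeStructure VC) : Nonempty (Congruence (E.homLeft C) (E'.homLeft C)) :=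
  ⟨(Classical.choice h).homLeft C⟩

omit [FiniteDimensional ℚ VA'] [FiniteDimensional ℚ VB'] [AddCommGroup VA'] [Module ℚ VA'] [AddCommGroup VB']
  [Module ℚ VB'] in
/-- `E ≡ E' ⇒ Hom(E', C) ≡ Hom(E, C)`. [cite: MacLane1963Homology, Ch. III §1] -/
theorem nonempty_congruence_homRight {E' : Extension A B VE'} (h : Nonempty (Congruence E E'))
    (C : MixedHodgeStructure VC) : Nonempty (Congruence (E'.homRight C) (E.homRight C)) :=
  ⟨(Classical.choice h).homRight C⟩

omit [FiniteDimensional ℚ VA'] [FiniteDimensional ℚ VB'] [FiniteDimensional ℚ VE'] [AddCommGroup VA']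
  [Module ℚ VA'] [AddCommGroup VB'] [Module ℚ VB'] [AddCommGroup VE'] [Module ℚ VE'] in
/-- **A splitting `s` of `E` gives the splitting `Hom(C, s)` of `Hom(C, E)`.** [cite: MacLane1963Homology, Ch. III §1] -/
def Splitting.homLeft (S : E.Splitting) (C : MixedHodgeStructure VC) : (E.homLeft C).Splitting where
  sec := Hom.homMap (Hom.id C) S.sec
  proj_comp := by
    change (Hom.homMap (Hom.id C) E.proj).toLinearMap ∘ₗ (Hom.homMap (Hom.id C) S.sec).toLinearMap = LinearMap.id
    rw [Hom.homMap_id_comp_toLinearMap, show E.proj.comp S.sec = Hom.id A from Hom.ext S.proj_comp,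
      Hom.homMap_id_id_toLinearMap]

variable (E) in
omit [FiniteDimensional ℚ VA] [FiniteDimensional ℚ VB] [FiniteDimensional ℚ VE] [FiniteDimensional ℚ VC]
  [FiniteDimensional ℚ VA'] [FiniteDimensional ℚ VB'] [FiniteDimensional ℚ VE'] [AddCommGroup VC] [Module ℚ VC]
  [AddCommGroup VA'] [Module ℚ VA'] [AddCommGroup VB'] [Module ℚ VB'] [AddCommGroup VE'] [Module ℚ VE'] in
/-- **The retraction `r = i⁻¹ ∘ (id - s ∘ π) : E → B` of a splitting is a morphism of mixed Hodge
structures** (`(id - sπ)(W_k E) ⊆ W_k E ∩ i(B) = i(W_k B)` and likewise for `F`, by strictness of `i`;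
Carlson 1980, §2(b): retractions `r` with `r ∘ i = id`). [cite: Carlson1980, §2(b)] -/
def Splitting.retractionHom (S : E.Splitting) : Hom E.mhs B where
  toLinearMap := E.retraction S.ratSection
  map_W_le k := by
    rintro _ ⟨e, he, rfl⟩
    refine E.mem_W_of_inc_mem ?_
    rw [inc_retraction]
    exact (E.mhs.W k).sub_mem he (S.sec.map_W_le k ⟨_, E.proj.map_W_le k ⟨e, he, rfl⟩, rfl⟩)
  map_F_le p := by
    rintro _ ⟨z, hz, rfl⟩
    refine E.mem_F_of_incC_mem ?_
    rw [incC_retraction_baseChange]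
    exact (E.mhs.F p).sub_mem hz (S.sec.map_F_le p ⟨_, E.proj.map_F_le p ⟨z, hz, rfl⟩, rfl⟩)

omit [FiniteDimensional ℚ VA] [FiniteDimensional ℚ VB] [FiniteDimensional ℚ VE] [FiniteDimensional ℚ VC]
  [FiniteDimensional ℚ VA'] [FiniteDimensional ℚ VB'] [FiniteDimensional ℚ VE'] [AddCommGroup VC] [Module ℚ VC]
  [AddCommGroup VA'] [Module ℚ VA'] [AddCommGroup VB'] [Module ℚ VB'] [AddCommGroup VE'] [Module ℚ VE'] in
/-- The underlying map of the retraction morphism (by `rfl`). [cite: Carlson1980, §2(b)] -/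
@[simp]
theorem Splitting.retractionHom_toLinearMap (S : E.Splitting) :
    S.retractionHom.toLinearMap = E.retraction S.ratSection := rfl

omit [FiniteDimensional ℚ VA] [FiniteDimensional ℚ VB] [FiniteDimensional ℚ VE] [FiniteDimensional ℚ VC]
  [FiniteDimensional ℚ VA'] [FiniteDimensional ℚ VB'] [FiniteDimensional ℚ VE'] [AddCommGroup VC] [Module ℚ VC]
  [AddCommGroup VA'] [Module ℚ VA'] [AddCommGroup VB'] [Module ℚ VB'] [AddCommGroup VE'] [Module ℚ VE'] in
/-- `r ∘ i = id_B` as morphisms. [cite: Carlson1980, §2(b)] -/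
theorem Splitting.retractionHom_comp_inc (S : E.Splitting) : S.retractionHom.comp E.inc = Hom.id B :=
  Hom.ext (LinearMap.ext fun b => E.retraction_inc S.ratSection b)

omit [FiniteDimensional ℚ VA'] [FiniteDimensional ℚ VB'] [FiniteDimensional ℚ VE'] [AddCommGroup VA']
  [Module ℚ VA'] [AddCommGroup VB'] [Module ℚ VB'] [AddCommGroup VE'] [Module ℚ VE'] in
/-- **A splitting of `E` gives the splitting `Hom(r, C)` of `Hom(E, C)`**, `r` the retraction of the
splitting (`Hom(i, C) ∘ Hom(r, C) = Hom(r ∘ i, C) = id`). [cite: MacLane1963Homology, Ch. III §1] -/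
def Splitting.homRight (S : E.Splitting) (C : MixedHodgeStructure VC) : (E.homRight C).Splitting where
  sec := Hom.homMap S.retractionHom (Hom.id C)
  proj_comp := by
    change (Hom.homMap E.inc (Hom.id C)).toLinearMap ∘ₗ (Hom.homMap S.retractionHom (Hom.id C)).toLinearMap =
      LinearMap.id
    rw [Hom.homMap_id_comp_toLinearMap', S.retractionHom_comp_inc, Hom.homMap_id_id_toLinearMap]

omit [FiniteDimensional ℚ VA'] [FiniteDimensional ℚ VB'] [FiniteDimensional ℚ VE'] [AddCommGroup VA']
  [Module ℚ VA'] [AddCommGroup VB'] [Module ℚ VB'] [AddCommGroup VE'] [Module ℚ VE'] in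
/-- **A split extension has split `Hom(C, E)`.** [cite: MacLane1963Homology, Ch. III §1] -/
theorem IsSplit.homLeft (h : E.IsSplit) (C : MixedHodgeStructure VC) : (E.homLeft C).IsSplit :=
  ⟨(Classical.choice h).homLeft C⟩

omit [FiniteDimensional ℚ VA'] [FiniteDimensional ℚ VB'] [FiniteDimensional ℚ VE'] [AddCommGroup VA']
  [Module ℚ VA'] [AddCommGroup VB'] [Module ℚ VB'] [AddCommGroup VE'] [Module ℚ VE'] in
/-- **A split extension has split `Hom(E, C)`.** [cite: MacLane1963Homology, Ch. III §1] -/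
theorem IsSplit.homRight (h : E.IsSplit) (C : MixedHodgeStructure VC) : (E.homRight C).IsSplit :=
  ⟨(Classical.choice h).homRight C⟩

/-! ### Push-out and pull-back commute with `Hom(C, −)` and `Hom(−, C)` up to congruence -/

variable (E) (C)

omit [FiniteDimensional ℚ VA'] [FiniteDimensional ℚ VE'] [AddCommGroup VA'] [Module ℚ VA'] [AddCommGroup VE']
  [Module ℚ VE'] in
/-- **`Hom(C, g)_* Hom(C, E) ≡ Hom(C, g_* E)`** (Mac Lane's uniqueness of the push-out: the morphism
`Hom(C, (g, ·, id_A))` has right component `Hom(C, id_A) = id`). [cite: MacLane1963Homology, Ch. III Lemma 1.4] -/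
def congruenceHomLeftPushout (g : Hom B B') :
    Congruence ((E.homLeft C).pushout (Hom.homMap (Hom.id C) g)) ((E.pushout g).homLeft C) :=
  Morphism.congruencePushout ((E.pushoutMorphism g).homLeft C) (Hom.homMap_id C A)

omit [FiniteDimensional ℚ VB'] [FiniteDimensional ℚ VE'] [AddCommGroup VB'] [Module ℚ VB'] [AddCommGroup VE']
  [Module ℚ VE'] in
/-- **`Hom(C, f^* E) ≡ Hom(C, f)^* Hom(C, E)`** (Mac Lane's uniqueness of the pull-back).
[cite: MacLane1963Homology, Ch. III Lemma 1.2] -/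
def congruenceHomLeftPullback (f : Hom A' A) :
    Congruence ((E.pullback f).homLeft C) ((E.homLeft C).pullback (Hom.homMap (Hom.id C) f)) :=
  Morphism.congruencePullback ((E.pullbackMorphism f).homLeft C) (Hom.homMap_id C B)

omit [FiniteDimensional ℚ VA'] [FiniteDimensional ℚ VE'] [AddCommGroup VA'] [Module ℚ VA'] [AddCommGroup VE']
  [Module ℚ VE'] in
/-- **`Hom(g_* E, C) ≡ Hom(g, C)^* Hom(E, C)`**: `Hom(−, C)` turns the push-out along `g` into the
pull-back along `Hom(g, C)` (the morphism `Hom((g, ·, id_A), C) : Hom(g_* E, C) → Hom(E, C)` has left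
component `Hom(id_A, C) = id`). [cite: MacLane1963Homology, Ch. III Lemma 1.2] -/
def congruenceHomRightPushout (g : Hom B B') :
    Congruence ((E.pushout g).homRight C) ((E.homRight C).pullback (Hom.homMap g (Hom.id C))) :=
  Morphism.congruencePullback ((E.pushoutMorphism g).homRight C) (Hom.homMap_id A C)

omit [FiniteDimensional ℚ VB'] [FiniteDimensional ℚ VE'] [AddCommGroup VB'] [Module ℚ VB'] [AddCommGroup VE']
  [Module ℚ VE'] in
/-- **`Hom(f, C)_* Hom(E, C) ≡ Hom(f^* E, C)`**: `Hom(−, C)` turns the pull-back along `f` into the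
push-out along `Hom(f, C)`. [cite: MacLane1963Homology, Ch. III Lemma 1.4] -/
def congruenceHomRightPullback (f : Hom A' A) :
    Congruence ((E.homRight C).pushout (Hom.homMap f (Hom.id C))) ((E.pullback f).homRight C) :=
  Morphism.congruencePushout ((E.pullbackMorphism f).homRight C) (Hom.homMap_id B C)

end Extension

/-! ### §3 The maps `Ext(A, B) → Ext(Hom(C, A), Hom(C, B))` and `Ext(A, B) → Ext(Hom(B, C), Hom(A, C))` -/

namespace Ext

variable {A : MixedHodgeStructure VA} {B : MixedHodgeStructure VB}
variable {A' : MixedHodgeStructure VA'} {B' : MixedHodgeStructure VB'}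
variable (C : MixedHodgeStructure VC)

omit [FiniteDimensional ℚ VE] [FiniteDimensional ℚ VA'] [FiniteDimensional ℚ VB'] [FiniteDimensional ℚ VE']
  [AddCommGroup VE] [Module ℚ VE] [AddCommGroup VA'] [Module ℚ VA'] [AddCommGroup VB'] [Module ℚ VB']
  [AddCommGroup VE'] [Module ℚ VE'] in
/-- **`Hom(C, −) : Ext(A, B) → Ext(Hom(C, A), Hom(C, B))`, `[E] ↦ [Hom(C, E)]`** (well defined: congruent
extensions have congruent `Hom(C, −)`). [cite: DeligneHodgeII1971, 1.1.12] [cite: Carlson1980, §2(b) Prop. 1] -/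
def homLeftMap : Ext A B → Ext (hom C A) (hom C B) :=
  Quotient.lift (s := extSetoid A B) (fun E => mkOfW (E.homLeft C))
    fun _ _ ⟨c⟩ => mkOfW_eq_of_congruence (c.homLeft C)

omit [FiniteDimensional ℚ VE] [FiniteDimensional ℚ VA'] [FiniteDimensional ℚ VB'] [FiniteDimensional ℚ VE']
  [AddCommGroup VE] [Module ℚ VE] [AddCommGroup VA'] [Module ℚ VA'] [AddCommGroup VB'] [Module ℚ VB']
  [AddCommGroup VE'] [Module ℚ VE'] in
/-- `homLeftMap C (mk E) = [Hom(C, E)]` (by `rfl`). [cite: DeligneHodgeII1971, 1.1.12] -/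
@[simp]
theorem homLeftMap_mk (E : Extension A B (VA × VB)) : homLeftMap C (mk E) = mkOfW (E.homLeft C) := rfl

omit [FiniteDimensional ℚ VA'] [FiniteDimensional ℚ VB'] [FiniteDimensional ℚ VE'] [AddCommGroup VA']
  [Module ℚ VA'] [AddCommGroup VB'] [Module ℚ VB'] [AddCommGroup VE'] [Module ℚ VE'] in
/-- **`homLeftMap C [E] = [Hom(C, E)]` for an extension on any (finite-dimensional) carrier.**
[cite: DeligneHodgeII1971, 1.1.12] -/
theorem homLeftMap_mkOfW (E : Extension A B VE) : homLeftMap C (mkOfW E) = mkOfW (E.homLeft C) := by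
  obtain ⟨E', hE'⟩ := mk_surjective (mkOfW E)
  have hc : Nonempty (Extension.Congruence E E') := by
    rw [← mkOfW_eq_mkOfW_iff, mkOfW_eq_mk, hE']
  rw [← hE', homLeftMap_mk]
  exact (mkOfW_eq_of_congruence ((Classical.choice hc).homLeft C)).symm

omit [FiniteDimensional ℚ VE] [FiniteDimensional ℚ VA'] [FiniteDimensional ℚ VB'] [FiniteDimensional ℚ VE']
  [AddCommGroup VE] [Module ℚ VE] [AddCommGroup VA'] [Module ℚ VA'] [AddCommGroup VB'] [Module ℚ VB']
  [AddCommGroup VE'] [Module ℚ VE'] in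
/-- `Hom(C, −)` sends the split class to the split class. [cite: MacLane1963Homology, Ch. III §1] -/
theorem homLeftMap_zeroW : homLeftMap C (zeroW : Ext A B) = zeroW := by
  rw [zeroW_eq_mk_splitW, homLeftMap_mk, mkOfW_eq_zeroW_iff]
  exact Extension.IsSplit.homLeft ((mkOfW_eq_zeroW_iff _).1 (by rw [mkOfW_eq_mk, ← zeroW_eq_mk_splitW])) C

omit [FiniteDimensional ℚ VA'] [FiniteDimensional ℚ VE] [FiniteDimensional ℚ VE'] [AddCommGroup VA']
  [Module ℚ VA'] [AddCommGroup VE] [Module ℚ VE] [AddCommGroup VE'] [Module ℚ VE'] in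
/-- **Naturality in the sub: `Hom(C, g_* x) = Hom(C, g)_* Hom(C, x)`.** [cite: MacLane1963Homology, Ch. III Lemma 1.4] -/
theorem homLeftMap_pushoutMapW (g : Hom B B') (x : Ext A B) :
    homLeftMap C (pushoutMapW g x) = pushoutMapW (Hom.homMap (Hom.id C) g) (homLeftMap C x) := by
  obtain ⟨E, rfl⟩ := mk_surjective x
  rw [← mkOfW_eq_mk, pushoutMapW_mkOfW, homLeftMap_mkOfW, homLeftMap_mkOfW, pushoutMapW_mkOfW]
  exact (mkOfW_eq_of_congruence (E.congruenceHomLeftPushout C g)).symm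

omit [FiniteDimensional ℚ VB'] [FiniteDimensional ℚ VE] [FiniteDimensional ℚ VE'] [AddCommGroup VB']
  [Module ℚ VB'] [AddCommGroup VE] [Module ℚ VE] [AddCommGroup VE'] [Module ℚ VE'] in
/-- **Naturality in the quotient: `Hom(C, f^* x) = Hom(C, f)^* Hom(C, x)`.** [cite: MacLane1963Homology, Ch. III Lemma 1.2] -/
theorem homLeftMap_pullbackMapW (f : Hom A' A) (x : Ext A B) :
    homLeftMap C (pullbackMapW f x) = pullbackMapW (Hom.homMap (Hom.id C) f) (homLeftMap C x) := by
  obtain ⟨E, rfl⟩ := mk_surjective x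
  rw [← mkOfW_eq_mk, pullbackMapW_mkOfW, homLeftMap_mkOfW, homLeftMap_mkOfW, pullbackMapW_mkOfW]
  exact mkOfW_eq_of_congruence (E.congruenceHomLeftPullback C f)

omit [FiniteDimensional ℚ VE] [FiniteDimensional ℚ VA'] [FiniteDimensional ℚ VB'] [FiniteDimensional ℚ VE']
  [AddCommGroup VE] [Module ℚ VE] [AddCommGroup VA'] [Module ℚ VA'] [AddCommGroup VB'] [Module ℚ VB']
  [AddCommGroup VE'] [Module ℚ VE'] in
/-- **`Hom(−, C) : Ext(A, B) → Ext(Hom(B, C), Hom(A, C))`, `[E] ↦ [Hom(E, C)]`** (contravariant in the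
pair: sub and quotient are exchanged). [cite: DeligneHodgeII1971, 1.1.12] [cite: Carlson1980, §2(c) Remark (3)] -/
def homRightMap : Ext A B → Ext (hom B C) (hom A C) :=
  Quotient.lift (s := extSetoid A B) (fun E => mkOfW (E.homRight C))
    fun _ _ ⟨c⟩ => (mkOfW_eq_of_congruence (c.homRight C)).symm

omit [FiniteDimensional ℚ VE] [FiniteDimensional ℚ VA'] [FiniteDimensional ℚ VB'] [FiniteDimensional ℚ VE']
  [AddCommGroup VE] [Module ℚ VE] [AddCommGroup VA'] [Module ℚ VA'] [AddCommGroup VB'] [Module ℚ VB']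
  [AddCommGroup VE'] [Module ℚ VE'] in
/-- `homRightMap C (mk E) = [Hom(E, C)]` (by `rfl`). [cite: DeligneHodgeII1971, 1.1.12] -/
@[simp]
theorem homRightMap_mk (E : Extension A B (VA × VB)) : homRightMap C (mk E) = mkOfW (E.homRight C) := rfl

omit [FiniteDimensional ℚ VA'] [FiniteDimensional ℚ VB'] [FiniteDimensional ℚ VE'] [AddCommGroup VA']
  [Module ℚ VA'] [AddCommGroup VB'] [Module ℚ VB'] [AddCommGroup VE'] [Module ℚ VE'] in
/-- **`homRightMap C [E] = [Hom(E, C)]` for an extension on any (finite-dimensional) carrier.**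
[cite: DeligneHodgeII1971, 1.1.12] -/
theorem homRightMap_mkOfW (E : Extension A B VE) : homRightMap C (mkOfW E) = mkOfW (E.homRight C) := by
  obtain ⟨E', hE'⟩ := mk_surjective (mkOfW E)
  have hc : Nonempty (Extension.Congruence E E') := by
    rw [← mkOfW_eq_mkOfW_iff, mkOfW_eq_mk, hE']
  rw [← hE', homRightMap_mk]
  exact mkOfW_eq_of_congruence ((Classical.choice hc).homRight C)

omit [FiniteDimensional ℚ VE] [FiniteDimensional ℚ VA'] [FiniteDimensional ℚ VB'] [FiniteDimensional ℚ VE']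
  [AddCommGroup VE] [Module ℚ VE] [AddCommGroup VA'] [Module ℚ VA'] [AddCommGroup VB'] [Module ℚ VB']
  [AddCommGroup VE'] [Module ℚ VE'] in
/-- `Hom(−, C)` sends the split class to the split class. [cite: MacLane1963Homology, Ch. III §1] -/
theorem homRightMap_zeroW : homRightMap C (zeroW : Ext A B) = zeroW := by
  rw [zeroW_eq_mk_splitW, homRightMap_mk, mkOfW_eq_zeroW_iff]
  exact Extension.IsSplit.homRight ((mkOfW_eq_zeroW_iff _).1 (by rw [mkOfW_eq_mk, ← zeroW_eq_mk_splitW])) C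

omit [FiniteDimensional ℚ VA'] [FiniteDimensional ℚ VE] [FiniteDimensional ℚ VE'] [AddCommGroup VA']
  [Module ℚ VA'] [AddCommGroup VE] [Module ℚ VE] [AddCommGroup VE'] [Module ℚ VE'] in
/-- **`Hom(g_* x, C) = Hom(g, C)^* Hom(x, C)`.** [cite: MacLane1963Homology, Ch. III Lemma 1.2] -/
theorem homRightMap_pushoutMapW (g : Hom B B') (x : Ext A B) :
    homRightMap C (pushoutMapW g x) = pullbackMapW (Hom.homMap g (Hom.id C)) (homRightMap C x) := by
  obtain ⟨E, rfl⟩ := mk_surjective x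
  rw [← mkOfW_eq_mk, pushoutMapW_mkOfW, homRightMap_mkOfW, homRightMap_mkOfW, pullbackMapW_mkOfW]
  exact mkOfW_eq_of_congruence (E.congruenceHomRightPushout C g)

omit [FiniteDimensional ℚ VB'] [FiniteDimensional ℚ VE] [FiniteDimensional ℚ VE'] [AddCommGroup VB']
  [Module ℚ VB'] [AddCommGroup VE] [Module ℚ VE] [AddCommGroup VE'] [Module ℚ VE'] in
/-- **`Hom(f^* x, C) = Hom(f, C)_* Hom(x, C)`.** [cite: MacLane1963Homology, Ch. III Lemma 1.4] -/
theorem homRightMap_pullbackMapW (f : Hom A' A) (x : Ext A B) :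
    homRightMap C (pullbackMapW f x) = pushoutMapW (Hom.homMap f (Hom.id C)) (homRightMap C x) := by
  obtain ⟨E, rfl⟩ := mk_surjective x
  rw [← mkOfW_eq_mk, pullbackMapW_mkOfW, homRightMap_mkOfW, homRightMap_mkOfW, pushoutMapW_mkOfW]
  exact (mkOfW_eq_of_congruence (E.congruenceHomRightPullback C f)).symm

end Ext

end MixedHodgeStructure

end Literature.AlgebraicGeometry.Motives

end
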